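/-
Copyright (c) 2026 the pub-hodgecm-mathlib formalisation cell (harness21).  Prover seat hodgecm-mathlib-F0P2-p01 (g15): road «S3-ram» (LEAD F0P3a-plan (g12); architect
A-p16 (g31); owner F0P3a-p06 (g15)), organ A′ (ii): J6 LABEL SIDE, the `hP` row («a rank-one vertex has ONE null line and one class») of the (a2) engine ★ p847302; 2026-09-02.
-/
import Literature.NumberTheory.Automorphic.UnitaryLatticeTreeEvenDepthRankRamified   -- ★ p847392 (this seat): `v_le_succ_of_sq_le`, the even half of the parity lemma; brings ★ H, G, F, E, D, ★ `UnitaryLatticeTreeFixedStar`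
import HarnessLib

/-!
# The lattice graph of a hermitian space — THE SHAPE OF A RANK-ONE FIXED VERTEX AT A TAME-RAMIFIED PLACE: `Ȳ = s·E₀₂` in the inward-adapted frame, so the residual form is
# `s·ū₂²`, the only null isotropic line is the inward one, and every other line has class `s` (Bruhat–Tits 1972 §10; Tits 1979 §3.5; Kottwitz 1986 §3)

Topic `NumberTheory/Automorphic`; namespace `Literature.NumberTheory.Automorphic.UnitaryLatticeTree`.  THEOREMS ONLY (no definition, no instance, no notation, no named fact,
no `sorry`); kernel lane `--supports stmt-HodgeConjecture-24833`.  Cell `pub/hodgecm-mathlib` (D-0151), crux H413; road «S3-ram» (Literature seeding, count-neutral), organ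
A′ (ii) of the P-1-ram skeleton (architect A-p16 (g31)); the LABEL side of the `hP` row of the tree-induction engine ★ p847302 («`P^c_m → q²·P^{χ(−1)c}_{m−1}`»: a
rank-one vertex of class `c` has `q²` fixed outward grandchildren, all rank one of class `χ(−1)·c`), in the valuation currency of ★ E ∕ F ∕ G ∕ H ∕ I ∕ J (no residue matrices).
J₀-MODEL (`J₀ = antidiag(1,1,1)`, `K₀ = U(σ,J₀) ∩ GL₃(𝒪)` = ★ `unitaryInt`, `N₁ = latt diag(1,1,ϖ)` the modular neighbour of `L₀ = 𝒪³` through the isotropic line `ē₀`);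
DATUM: `σ` valuation-preserving, `σϖ = −ϖ`, residually trivial.

THE MATHEMATICS.  Let `γ ∈ U(σ, J₀)` (the element seen from the vertex, `u⁻¹γu`) with `Y := γ − 1` of level `ϖ^d`, `d` ODD.  §1: the odd half of the parity lemma —
`σ(y) ≡ −y (ϖ^{d+1})` for `|y| ≤ |ϖ|^d` (`σ(ϖ^d) = −ϖ^d`), so ★ G's skew-hermitian law `Y_{ij} + σ(Y_{rev j,rev i}) ≡ 0 (ϖ^{2d})` becomes **`Y_{ij} ≡ Y_{rev j, rev i} (ϖ^{d+1})`**: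
the residual `S = J̄₀Ȳ` is SYMMETRIC (`v_coe_sub_one_apply_sub_rev_le_of_odd`).  §2: if moreover the vertex has rank `≤ 1` in the sense of the tokens — `Y²` of level
`ϖ^{2d+1}` — and its inward line `ē₀` lies in the kernel (`Y_{i0} ≡ 0`; ★ J §1: the parent is deeper, §2: nilpotency), then symmetry leaves `Ȳ = !![0,γ′,s; 0,β′,γ′; 0,0,0]` and
`Ȳ² = 0` kills `β′` (`(Ȳ²)₁₁ = β′²`) and `γ′` (`(Ȳ²)₀₂ = γ′²`): **`Ȳ = s·E₀₂`**, i.e. `|Y_{ij}| ≤ |ϖ|^{d+1}` for `(i,j) ≠ (0,2)` (`forall_v_coe_sub_one_le_succ_of_sq_le_of_col`).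
§3: hence the form on `L₀`: **`|B₀(u, Yu) − u₂²·Y₀₂| < |ϖ|^d`** for `u ∈ 𝒪³` (`v_B₀_mulVec_sub_sq_mul_lt_of_shape`) — `Q_Ȳ(ū) = s·ū₂²`, ONE square class `s = cl(ϖ^{−d}Y₀₂)`
for all values (p05's one-class dictionary ★ p847189, here at valuation level); through the modular neighbour `κ·N₁` (`κ ∈ K₀`, line `κ̄ē₀`) the corner of ★ p847060 ∕ p847085 is
`(κ⁻¹Yκ)₂₀ ≡ κ₂₀²·Y₀₂` (`v_conj_apply_two_zero_sub_lt_of_shape`), so when the depth is EXACTLY `d` (`|Y₀₂| = |ϖ|^d`) the line is `Q_Ȳ`-NULL iff `|κ₂₀| < 1`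
(`v_conj_apply_two_zero_le_iff_of_shape`) iff — `κ̄ē₀` being isotropic, `|κ₂₀| < 1 ⇒ |κ₁₀| < 1` (§4) — `κ·N₁ = N₁` is the INWARD neighbour (`mapGL_N₁_eq_iff_v_apply_two_zero_lt_one`,
over ★ `mapGL_N₁_eq_mapGL_N₁_iff`).  So all `q` outward neighbours are non-null with corner class `cl(Y₀₂)`: by ★ p847085 each carries `q` fixed children, by ★ H
`exists_mem_childLatt_class_neg_of_lineClass` + `map_sub_one_sq_childLatt_le_scaleLattice_of_le` each child is `(d−2, rank ≤ 1, CLS(−s))` — the `hP` row.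

* §1 `v_sigma_add_self_le_of_odd`, **`v_coe_sub_one_apply_sub_rev_le_of_odd`** (symmetric residual form at odd depth).
* §2 **`forall_v_coe_sub_one_le_succ_of_sq_le_of_col`** (`Ȳ = s·E₀₂`).
* §3 **`v_B₀_mulVec_sub_sq_mul_lt_of_shape`** (`Q_Ȳ(ū) = s·ū₂²`), **`v_conj_apply_two_zero_sub_lt_of_shape`**, **`v_conj_apply_two_zero_le_iff_of_shape`** (null iff `|κ₂₀| < 1`).
* §4 `v_apply_one_zero_lt_one_of_v_apply_two_zero_lt_one` (isotropy of `κ̄ē₀`), `v_apply_zero_zero_eq_one_of_v_apply_two_zero_lt_one` (primitive column),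
  **`mapGL_N₁_eq_iff_v_apply_two_zero_lt_one`** (`κ·N₁ = N₁ ↔ |κ₂₀| < 1` for `κ ∈ K₀`).

HONEST LABEL: HC_CM is proved only modulo the 2 remaining named inputs (hLiu418 24832, h413 24833) until rung 0 closes; nothing printed is asserted here (elementary algebra
over a valuation ring); «S3-ram» has no books consequence.

## References
* [BruhatTits1972] F. Bruhat, J. Tits, *Groupes réductifs sur un corps local I*, Publ. Math. IHÉS 41 (1972), §10 (lattice models; vertex stabilisers and their filtrations).
* [Tits1979] J. Tits, *Reductive groups over local fields*, PSPM 33.1 (1979), §3.5 (congruence filtration; reduction mod `𝔭` of a parahoric).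
* [Kottwitz1986] R. E. Kottwitz, *Base change for unit elements of Hecke algebras*, Compositio Math. 60 (1986), §3 (levels of fixed lattices; shell recursion).
* [Serre1980Trees] J.-P. Serre, *Trees* (1980), Ch. II §1.1–1.2 (neighbours of a lattice = lines of its reduction).
-/

set_option autoImplicit false

noncomputable section

open scoped Valued WithZero Matrix MatrixGroups

namespace Literature.NumberTheory.Automorphic.UnitaryLatticeTree

open Literature.NumberTheory.Automorphic Literature.NumberTheory.Automorphic.HermitianLattice

variable {K : Type*} [Field K] [Valued K ℤᵐ⁰] {σ : K →+* K} {ϖ : K}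

/-! ## §1 The symmetric residual form at odd depth -/

/-- **`σ(y) ≡ −y (mod ϖ^{d+1})` for `|y| ≤ |ϖ|^d`, `d` odd** (`σϖ = −ϖ`, `σ` residually trivial): `y = ϖ^d·u`, `σ(ϖ^d) = (−ϖ)^d = −ϖ^d`, `|σu − u| < 1`.
[cite: Tits1979, §3.5] [cite: BruhatTits1972, §10] -/
theorem v_sigma_add_self_le_of_odd (hσϖ : σ ϖ = -ϖ) (hϖ : Valued.v ϖ = WithZero.exp (-1 : ℤ))
    (hres : ∀ x : K, Valued.v x ≤ 1 → Valued.v (σ x - x) < 1) {d : ℕ} (hd : Odd d) {y : K} (hy : Valued.v y ≤ Valued.v ϖ ^ d) :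
    Valued.v (σ y + y) ≤ Valued.v ϖ ^ (d + 1) := by
  have hϖ0 : ϖ ≠ 0 := fun h0 => by rw [h0, map_zero] at hϖ; exact WithZero.coe_ne_zero hϖ.symm
  have hvϖ0 : Valued.v ϖ ≠ 0 := (Valuation.ne_zero_iff _).2 hϖ0
  have hu : Valued.v ((ϖ ^ d)⁻¹ * y) ≤ 1 := by
    rw [map_mul, map_inv₀, map_pow]
    calc (Valued.v ϖ ^ d)⁻¹ * Valued.v y ≤ (Valued.v ϖ ^ d)⁻¹ * Valued.v ϖ ^ d := mul_le_mul' le_rfl hy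
      _ = 1 := inv_mul_cancel₀ (pow_ne_zero _ hvϖ0)
  have hσpow : σ (ϖ ^ d) = -ϖ ^ d := by rw [map_pow, hσϖ, hd.neg_pow]
  have e : σ y + y = -(ϖ ^ d * (σ ((ϖ ^ d)⁻¹ * y) - (ϖ ^ d)⁻¹ * y)) := by
    rw [map_mul, map_inv₀, hσpow]; field_simp; ring
  rw [e, Valuation.map_neg, map_mul, map_pow, pow_succ]
  refine mul_le_mul' le_rfl ?_
  have hlt := hres _ hu
  have h1 : (1 : ℤᵐ⁰) = Valued.v ϖ * WithZero.exp (1 : ℤ) := by rw [hϖ, ← WithZero.exp_add]; norm_num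
  rw [h1] at hlt
  exact (WithZero.lt_mul_exp_iff_le hvϖ0).1 hlt

/-- **SYMMETRY AT ODD DEPTH**: for `γ ∈ U(σ, J₀)` with `Y = γ − 1` of level `ϖ^d`, `d` odd: `|Y_{ij} − Y_{rev j, rev i}| ≤ |ϖ|^{d+1}` — the residual `J̄₀Ȳ` is symmetric (the
odd half of the parity lemma of the (a2) law table; ★ p847392 has the even half). [cite: Tits1979, §3.5] [cite: BruhatTits1972, §10] -/
theorem v_coe_sub_one_apply_sub_rev_le_of_odd (hvσ : ∀ z, Valued.v (σ z) = Valued.v z) (hσϖ : σ ϖ = -ϖ) (hϖ : Valued.v ϖ = WithZero.exp (-1 : ℤ))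
    (hres : ∀ x : K, Valued.v x ≤ 1 → Valued.v (σ x - x) < 1)
    (γ : unitaryGroupOfForm σ ((StdForm.antidiagonal 3).over K)) {d : ℕ} (hd : Odd d)
    (hY : ∀ i j, Valued.v ((((γ : GL (Fin 3) K) : Matrix (Fin 3) (Fin 3) K) - 1) i j) ≤ Valued.v ϖ ^ d) (i j : Fin 3) :
    Valued.v ((((γ : GL (Fin 3) K) : Matrix (Fin 3) (Fin 3) K) - 1) i j - (((γ : GL (Fin 3) K) : Matrix (Fin 3) (Fin 3) K) - 1) j.rev i.rev) ≤ Valued.v ϖ ^ (d + 1) := by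
  set Y : Matrix (Fin 3) (Fin 3) K := ((γ : GL (Fin 3) K) : Matrix (Fin 3) (Fin 3) K) - 1 with hYdef
  have hϖ1 : Valued.v ϖ ≤ 1 := by rw [hϖ, ← WithZero.exp_zero]; exact WithZero.exp_le_exp.2 (by norm_num)
  have hd1 : 1 ≤ d := hd.pos
  have hskew := v_coe_sub_one_apply_add_sigma_rev_le hvσ γ hY i j
  have hσ := v_sigma_add_self_le_of_odd hσϖ hϖ hres hd (hY j.rev i.rev)
  have h2d : Valued.v ϖ ^ d * Valued.v ϖ ^ d ≤ Valued.v ϖ ^ (d + 1) := by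
    rw [← pow_add]; exact pow_le_pow_right_of_le_one' hϖ1 (by omega)
  have e : Y i j - Y j.rev i.rev = (Y i j + σ (Y j.rev i.rev)) - (σ (Y j.rev i.rev) + Y j.rev i.rev) := by ring
  rw [e]
  exact (Valuation.map_sub _ _ _).trans (max_le (hskew.trans h2d) hσ)

/-! ## §2 The shape `Ȳ = s·E₀₂` of a rank-one vertex in its inward-adapted frame -/

/-- **THE SHAPE OF A RANK-ONE VERTEX**: `γ ∈ U(σ, J₀)`, `Y = γ − 1` of level `ϖ^d`, `d` odd, `Y²` of level `ϖ^{2d+1}` (token `LEV₂ (ϖ^{2d+1})`: rank `≤ 1`) and the inward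
line in the kernel (`|Y_{i0}| ≤ |ϖ|^{d+1}` for all `i`): then **`|Y_{ij}| ≤ |ϖ|^{d+1}` for every `(i,j) ≠ (0,2)`** — residually `Ȳ = s·E₀₂`, `s = red(ϖ^{−d}Y₀₂)`.
[cite: Tits1979, §3.5] [cite: Kottwitz1986, §3] [cite: BruhatTits1972, §10] -/
theorem forall_v_coe_sub_one_le_succ_of_sq_le_of_col (hvσ : ∀ z, Valued.v (σ z) = Valued.v z) (hσϖ : σ ϖ = -ϖ) (hϖ : Valued.v ϖ = WithZero.exp (-1 : ℤ))
    (hres : ∀ x : K, Valued.v x ≤ 1 → Valued.v (σ x - x) < 1)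
    (γ : unitaryGroupOfForm σ ((StdForm.antidiagonal 3).over K)) {d : ℕ} (hd : Odd d)
    (hY : ∀ i j, Valued.v ((((γ : GL (Fin 3) K) : Matrix (Fin 3) (Fin 3) K) - 1) i j) ≤ Valued.v ϖ ^ d)
    (hsq : ∀ i j, Valued.v (((((γ : GL (Fin 3) K) : Matrix (Fin 3) (Fin 3) K) - 1) * ((((γ : GL (Fin 3) K) : Matrix (Fin 3) (Fin 3) K) - 1))) i j) ≤ Valued.v ϖ ^ (2 * d + 1))
    (hcol : ∀ i, Valued.v ((((γ : GL (Fin 3) K) : Matrix (Fin 3) (Fin 3) K) - 1) i 0) ≤ Valued.v ϖ ^ (d + 1))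
    {i j : Fin 3} (hij : ¬ (i = 0 ∧ j = 2)) :
    Valued.v ((((γ : GL (Fin 3) K) : Matrix (Fin 3) (Fin 3) K) - 1) i j) ≤ Valued.v ϖ ^ (d + 1) := by
  have hsym := v_coe_sub_one_apply_sub_rev_le_of_odd hvσ hσϖ hϖ hres γ hd hY
  set Y : Matrix (Fin 3) (Fin 3) K := ((γ : GL (Fin 3) K) : Matrix (Fin 3) (Fin 3) K) - 1 with hYdef
  have hr0 : (0 : Fin 3).rev = 2 := rfl
  have hr1 : (1 : Fin 3).rev = 1 := rfl
  have hr2 : (2 : Fin 3).rev = 0 := rfl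
  have h00 : Valued.v (Y 0 0) ≤ Valued.v ϖ ^ (d + 1) := hcol 0
  have h10 : Valued.v (Y 1 0) ≤ Valued.v ϖ ^ (d + 1) := hcol 1
  have h20 : Valued.v (Y 2 0) ≤ Valued.v ϖ ^ (d + 1) := hcol 2
  -- symmetric partners: `Y₂₂ ≡ Y₀₀`, `Y₂₁ ≡ Y₁₀`, `Y₀₁ ≡ Y₁₂`
  have h22 : Valued.v (Y 2 2) ≤ Valued.v ϖ ^ (d + 1) := by
    have h := hsym 2 2; rw [hr2] at h
    have e : Y 2 2 = (Y 2 2 - Y 0 0) + Y 0 0 := by ring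
    rw [e]; exact (Valuation.map_add _ _ _).trans (max_le h h00)
  have h21 : Valued.v (Y 2 1) ≤ Valued.v ϖ ^ (d + 1) := by
    have h := hsym 2 1; rw [hr1, hr2] at h
    have e : Y 2 1 = (Y 2 1 - Y 1 0) + Y 1 0 := by ring
    rw [e]; exact (Valuation.map_add _ _ _).trans (max_le h h10)
  have hs01 : Valued.v (Y 0 1 - Y 1 2) ≤ Valued.v ϖ ^ (d + 1) := by have h := hsym 0 1; rw [hr1, hr0] at h; exact h
  -- product bounds
  have hsum : Valued.v ϖ ^ (2 * d + 1) = Valued.v ϖ ^ (d + 1) * Valued.v ϖ ^ d := by rw [← pow_add]; congr 1; omega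
  have hprod : ∀ {x y : K}, Valued.v x ≤ Valued.v ϖ ^ (d + 1) → Valued.v y ≤ Valued.v ϖ ^ d → Valued.v (x * y) ≤ Valued.v ϖ ^ (2 * d + 1) :=
    fun {x y} hx hy => by rw [map_mul, hsum]; exact mul_le_mul' hx hy
  have hprod' : ∀ {x y : K}, Valued.v x ≤ Valued.v ϖ ^ d → Valued.v y ≤ Valued.v ϖ ^ (d + 1) → Valued.v (x * y) ≤ Valued.v ϖ ^ (2 * d + 1) :=
    fun {x y} hx hy => by rw [mul_comm]; exact hprod hy hx
  have hsq' : ∀ a c : Fin 3, Valued.v (Y a 0 * Y 0 c + Y a 1 * Y 1 c + Y a 2 * Y 2 c) ≤ Valued.v ϖ ^ (2 * d + 1) := by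
    intro a c
    have h := hsq a c
    rwa [Matrix.mul_apply, Fin.sum_univ_three] at h
  -- `β′ = Y₁₁`: `(Y²)₁₁ = Y₁₀Y₀₁ + Y₁₁² + Y₁₂Y₂₁`
  have h11 : Valued.v (Y 1 1) ≤ Valued.v ϖ ^ (d + 1) := by
    refine v_le_succ_of_sq_le hϖ (hY 1 1) ?_
    have e : Y 1 1 * Y 1 1 = (Y 1 0 * Y 0 1 + Y 1 1 * Y 1 1 + Y 1 2 * Y 2 1) - Y 1 0 * Y 0 1 - Y 1 2 * Y 2 1 := by ring
    rw [e]
    exact (Valuation.map_sub _ _ _).trans (max_le ((Valuation.map_sub _ _ _).trans (max_le (hsq' 1 1) (hprod h10 (hY 0 1)))) (hprod' (hY 1 2) h21))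
  -- `γ′ = Y₁₂ ≡ Y₀₁`: `(Y²)₀₂ = Y₀₀Y₀₂ + Y₀₁Y₁₂ + Y₀₂Y₂₂`
  have h12 : Valued.v (Y 1 2) ≤ Valued.v ϖ ^ (d + 1) := by
    refine v_le_succ_of_sq_le hϖ (hY 1 2) ?_
    have e : Y 1 2 * Y 1 2 = (Y 0 0 * Y 0 2 + Y 0 1 * Y 1 2 + Y 0 2 * Y 2 2) - Y 0 0 * Y 0 2 - Y 0 2 * Y 2 2 - (Y 0 1 - Y 1 2) * Y 1 2 := by ring
    rw [e]
    refine (Valuation.map_sub _ _ _).trans (max_le ((Valuation.map_sub _ _ _).trans (max_le ((Valuation.map_sub _ _ _).trans (max_le (hsq' 0 2) ?_)) ?_)) ?_)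
    · exact hprod h00 (hY 0 2)
    · exact hprod' (hY 0 2) h22
    · exact hprod hs01 (hY 1 2)
  have h01 : Valued.v (Y 0 1) ≤ Valued.v ϖ ^ (d + 1) := by
    have e : Y 0 1 = (Y 0 1 - Y 1 2) + Y 1 2 := by ring
    rw [e]; exact (Valuation.map_add _ _ _).trans (max_le hs01 h12)
  fin_cases i <;> fin_cases j
  · exact h00
  · exact h01
  · exact absurd ⟨rfl, rfl⟩ hij
  · exact h10
  · exact h11
  · exact h12
  · exact h20
  · exact h21
  · exact h22

/-! ## §3 The residual form `Q_Ȳ(ū) = s·ū₂²` and the null test per modular neighbour -/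

/-- **THE FORM OF A RANK-ONE VERTEX**: if `|Y_{ij}| ≤ |ϖ|^d` and `|Y_{ij}| ≤ |ϖ|^{d+1}` for `(i,j) ≠ (0,2)` (§2), then for every `u ∈ 𝒪³`: **`|B₀(u, Yu) − u₂²·Y₀₂| < |ϖ|^d`** —
residually `Q_Ȳ(ū) = s·ū₂²` (`σ` valuation-preserving, residually trivial). [cite: Kottwitz1986, §3] [cite: Tits1979, §3.5] -/
theorem v_B₀_mulVec_sub_sq_mul_lt_of_shape (hvσ : ∀ z, Valued.v (σ z) = Valued.v z) (hϖ : Valued.v ϖ = WithZero.exp (-1 : ℤ))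
    (hres : ∀ x : K, Valued.v x ≤ 1 → Valued.v (σ x - x) < 1)
    {d : ℕ} {Y : Matrix (Fin 3) (Fin 3) K} (hY : ∀ i j, Valued.v (Y i j) ≤ Valued.v ϖ ^ d)
    (hshape : ∀ i j : Fin 3, ¬ (i = 0 ∧ j = 2) → Valued.v (Y i j) ≤ Valued.v ϖ ^ (d + 1))
    {u : Fin 3 → K} (hu : ∀ i, Valued.v (u i) ≤ 1) :
    Valued.v (B₀ σ 3 u (Y.mulVec u) - u 2 ^ 2 * Y 0 2) < Valued.v ϖ ^ d := by
  have hϖ0 : ϖ ≠ 0 := fun h0 => by rw [h0, map_zero] at hϖ; exact WithZero.coe_ne_zero hϖ.symm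
  have hvϖ0 : Valued.v ϖ ≠ 0 := (Valuation.ne_zero_iff _).2 hϖ0
  have hϖlt : Valued.v ϖ < 1 := by rw [hϖ, ← WithZero.exp_zero]; exact WithZero.exp_lt_exp.2 (by norm_num)
  have hne : Valued.v ϖ ^ d ≠ 0 := pow_ne_zero _ hvϖ0
  have hlt : Valued.v ϖ ^ (d + 1) < Valued.v ϖ ^ d := by
    rw [pow_succ]; exact mul_lt_of_lt_one_right (zero_lt_iff.2 hne) hϖlt
  -- a small entry times two integral coordinates
  have hsmall : ∀ {i j : Fin 3}, ¬ (i = 0 ∧ j = 2) → ∀ a c : K, Valued.v a ≤ 1 → Valued.v c ≤ 1 → Valued.v (a * Y i j * c) ≤ Valued.v ϖ ^ (d + 1) := by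
    intro i j hij a c ha hc
    rw [map_mul, map_mul]
    exact (mul_le_of_le_one_right' hc).trans ((mul_le_of_le_one_left zero_le ha).trans (hshape i j hij))
  have hσu : ∀ i, Valued.v (σ (u i)) ≤ 1 := fun i => by rw [hvσ]; exact hu i
  -- expand `B₀(u, Yu)`; the leading term is `σ(u₂)·Y₀₂·u₂`
  have e : B₀ σ 3 u (Y.mulVec u) - u 2 ^ 2 * Y 0 2 =
      (σ (u 0) * Y 2 0 * u 0 + σ (u 0) * Y 2 1 * u 1 + σ (u 0) * Y 2 2 * u 2) +
      (σ (u 1) * Y 1 0 * u 0 + σ (u 1) * Y 1 1 * u 1 + σ (u 1) * Y 1 2 * u 2) +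
      (σ (u 2) * Y 0 0 * u 0 + σ (u 2) * Y 0 1 * u 1) + (σ (u 2) * u 2 - u 2 ^ 2) * Y 0 2 := by
    rw [B₀_apply]
    simp [Matrix.mulVec, dotProduct, Fin.sum_univ_three, Fin.rev]
    ring
  rw [e]
  refine Valuation.map_add_lt _ ((?_ : _ ≤ Valued.v ϖ ^ (d + 1)).trans_lt hlt) ?_
  · refine (Valuation.map_add _ _ _).trans (max_le ((Valuation.map_add _ _ _).trans (max_le ?_ ?_)) ?_)
    · exact (Valuation.map_add _ _ _).trans (max_le ((Valuation.map_add _ _ _).trans (max_le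
        (hsmall (by decide) _ _ (hσu 0) (hu 0)) (hsmall (by decide) _ _ (hσu 0) (hu 1)))) (hsmall (by decide) _ _ (hσu 0) (hu 2)))
    · exact (Valuation.map_add _ _ _).trans (max_le ((Valuation.map_add _ _ _).trans (max_le
        (hsmall (by decide) _ _ (hσu 1) (hu 0)) (hsmall (by decide) _ _ (hσu 1) (hu 1)))) (hsmall (by decide) _ _ (hσu 1) (hu 2)))
    · exact (Valuation.map_add _ _ _).trans (max_le (hsmall (by decide) _ _ (hσu 2) (hu 0)) (hsmall (by decide) _ _ (hσu 2) (hu 1)))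
  · -- `|σ(u₂)u₂ − u₂²| < 1`, times `|Y₀₂| ≤ |ϖ|^d`
    rw [map_mul, mul_comm]
    calc Valued.v (Y 0 2) * Valued.v (σ (u 2) * u 2 - u 2 ^ 2) < Valued.v ϖ ^ d * 1 :=
          mul_lt_mul_of_le_of_lt_of_nonneg_of_pos (hY 0 2) (v_sigma_mul_self_sub_sq_lt hres (hu 2)) zero_le (zero_lt_iff.2 hne)
      _ = Valued.v ϖ ^ d := mul_one _

/-- **THE CORNER THROUGH THE NEIGHBOUR `κ·N₁` IS `κ₂₀²·Y₀₂`**: for `κ ∈ K₀`, `|(κ⁻¹Yκ)₂₀ − κ₂₀²·Y₀₂| < |ϖ|^d` (★ `inv_mul_mul_apply_two_zero_eq_B₀`: the corner is `B₀(κe₀, Yκe₀)`).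
[cite: Kottwitz1986, §3] [cite: BruhatTits1972, §10] -/
theorem v_conj_apply_two_zero_sub_lt_of_shape (hvσ : ∀ z, Valued.v (σ z) = Valued.v z) (hϖ : Valued.v ϖ = WithZero.exp (-1 : ℤ))
    (hres : ∀ x : K, Valued.v x ≤ 1 → Valued.v (σ x - x) < 1)
    {d : ℕ} {Y : Matrix (Fin 3) (Fin 3) K} (hY : ∀ i j, Valued.v (Y i j) ≤ Valued.v ϖ ^ d)
    (hshape : ∀ i j : Fin 3, ¬ (i = 0 ∧ j = 2) → Valued.v (Y i j) ≤ Valued.v ϖ ^ (d + 1))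
    {κ : unitaryGroupOfForm σ ((StdForm.antidiagonal 3).over K)} (hκ : κ ∈ unitaryInt σ ((StdForm.antidiagonal 3).over K)) :
    Valued.v (((((κ : GL (Fin 3) K)⁻¹ : GL (Fin 3) K) : Matrix (Fin 3) (Fin 3) K) * Y * ((κ : GL (Fin 3) K) : Matrix (Fin 3) (Fin 3) K)) 2 0 -
      ((κ : GL (Fin 3) K) : Matrix (Fin 3) (Fin 3) K) 2 0 ^ 2 * Y 0 2) < Valued.v ϖ ^ d := by
  rw [inv_mul_mul_apply_two_zero_eq_B₀ κ Y]
  exact v_B₀_mulVec_sub_sq_mul_lt_of_shape hvσ hϖ hres hY hshape (u := fun i => ((κ : GL (Fin 3) K) : Matrix (Fin 3) (Fin 3) K) i 0)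
    (fun i => (mem_unitaryInt_iff.1 hκ).1 i 0)

/-- **THE NULL TEST AT A RANK-ONE VERTEX OF EXACT DEPTH `d`** (`|Y₀₂| = |ϖ|^d`): through `κ·N₁`, `κ ∈ K₀`, the line is `Q_Ȳ`-null (`|(κ⁻¹Yκ)₂₀| ≤ |ϖ|^{d+1}`, the test of
★ p847060 ∕ p847085 for the children to be fixed) **iff `|κ₂₀| < 1`**. [cite: Kottwitz1986, §3] [cite: BruhatTits1972, §10] [cite: Tits1979, §3.5] -/
theorem v_conj_apply_two_zero_le_iff_of_shape (hvσ : ∀ z, Valued.v (σ z) = Valued.v z) (hϖ : Valued.v ϖ = WithZero.exp (-1 : ℤ))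
    (hres : ∀ x : K, Valued.v x ≤ 1 → Valued.v (σ x - x) < 1)
    {d : ℕ} {Y : Matrix (Fin 3) (Fin 3) K} (hY : ∀ i j, Valued.v (Y i j) ≤ Valued.v ϖ ^ d)
    (hshape : ∀ i j : Fin 3, ¬ (i = 0 ∧ j = 2) → Valued.v (Y i j) ≤ Valued.v ϖ ^ (d + 1)) (h02 : Valued.v (Y 0 2) = Valued.v ϖ ^ d)
    {κ : unitaryGroupOfForm σ ((StdForm.antidiagonal 3).over K)} (hκ : κ ∈ unitaryInt σ ((StdForm.antidiagonal 3).over K)) :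
    Valued.v (((((κ : GL (Fin 3) K)⁻¹ : GL (Fin 3) K) : Matrix (Fin 3) (Fin 3) K) * Y * ((κ : GL (Fin 3) K) : Matrix (Fin 3) (Fin 3) K)) 2 0) ≤ Valued.v ϖ ^ (d + 1) ↔
      Valued.v (((κ : GL (Fin 3) K) : Matrix (Fin 3) (Fin 3) K) 2 0) < 1 := by
  have hϖ0 : ϖ ≠ 0 := fun h0 => by rw [h0, map_zero] at hϖ; exact WithZero.coe_ne_zero hϖ.symm
  have hvϖ0 : Valued.v ϖ ≠ 0 := (Valuation.ne_zero_iff _).2 hϖ0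
  have hϖlt : Valued.v ϖ < 1 := by rw [hϖ, ← WithZero.exp_zero]; exact WithZero.exp_lt_exp.2 (by norm_num)
  have hne : Valued.v ϖ ^ d ≠ 0 := pow_ne_zero _ hvϖ0
  have hlt : Valued.v ϖ ^ (d + 1) < Valued.v ϖ ^ d := by
    rw [pow_succ]; exact mul_lt_of_lt_one_right (zero_lt_iff.2 hne) hϖlt
  have hdm : Valued.v ϖ ^ d = Valued.v ϖ ^ (d + 1) * WithZero.exp (1 : ℤ) := by
    rw [pow_succ, hϖ, mul_assoc, ← WithZero.exp_add]; norm_num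
  have happrox := v_conj_apply_two_zero_sub_lt_of_shape hvσ hϖ hres hY hshape hκ
  set c : K := ((((κ : GL (Fin 3) K)⁻¹ : GL (Fin 3) K) : Matrix (Fin 3) (Fin 3) K) * Y * ((κ : GL (Fin 3) K) : Matrix (Fin 3) (Fin 3) K)) 2 0 with hc
  set k : K := ((κ : GL (Fin 3) K) : Matrix (Fin 3) (Fin 3) K) 2 0 with hk
  have hk1 : Valued.v k ≤ 1 := (mem_unitaryInt_iff.1 hκ).1 2 0
  constructor
  · intro hle
    by_contra hk'
    have hkeq : Valued.v k = 1 := le_antisymm hk1 (not_lt.1 hk')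
    have hmain : Valued.v (k ^ 2 * Y 0 2) = Valued.v ϖ ^ d := by rw [map_mul, map_pow, hkeq, one_pow, one_mul, h02]
    -- `|c − k²Y₀₂| < |ϖ|^d = |k²Y₀₂|` forces `|c| = |ϖ|^d`, contradicting `|c| ≤ |ϖ|^(d+1)`
    have hceq : Valued.v c = Valued.v ϖ ^ d := by
      rw [← hmain]; exact Valuation.map_eq_of_sub_lt _ (hmain.symm ▸ happrox)
    exact (lt_irrefl _) ((hle.trans_lt hlt).trans_eq hceq.symm)
  · intro hk'
    -- `|k²Y₀₂| < |ϖ|^d`, so `|c| < |ϖ|^d`, i.e. `≤ |ϖ|^(d+1)`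
    have hsmall : Valued.v (k ^ 2 * Y 0 2) < Valued.v ϖ ^ d := by
      rw [map_mul, map_pow, h02]
      calc Valued.v k ^ 2 * Valued.v ϖ ^ d < 1 * Valued.v ϖ ^ d :=
            mul_lt_mul_of_pos_right (pow_lt_one₀ zero_le hk' two_ne_zero) (zero_lt_iff.2 hne)
        _ = Valued.v ϖ ^ d := one_mul _
    have hclt : Valued.v c < Valued.v ϖ ^ d := by
      have e : c = (c - k ^ 2 * Y 0 2) + k ^ 2 * Y 0 2 := by ring
      rw [e]; exact Valuation.map_add_lt _ happrox hsmall
    rw [hdm] at hclt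
    exact (WithZero.lt_mul_exp_iff_le (pow_ne_zero _ hvϖ0)).1 hclt

/-! ## §4 `|κ₂₀| < 1` singles out the inward neighbour -/

/-- **Isotropy of `κ̄ē₀`**: for `κ ∈ K₀`, `|κ₂₀| < 1 ⇒ |κ₁₀| < 1` (`B₀(κe₀, κe₀) = B₀(e₀, e₀) = 0`: `σ(κ₀₀)κ₂₀ + σ(κ₁₀)κ₁₀ + σ(κ₂₀)κ₀₀ = 0`).
[cite: BruhatTits1972, §10] [cite: Serre1980Trees, II.1.1] -/
theorem v_apply_one_zero_lt_one_of_v_apply_two_zero_lt_one (hvσ : ∀ z, Valued.v (σ z) = Valued.v z)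
    {κ : unitaryGroupOfForm σ ((StdForm.antidiagonal 3).over K)} (hκ : κ ∈ unitaryInt σ ((StdForm.antidiagonal 3).over K))
    (h20 : Valued.v (((κ : GL (Fin 3) K) : Matrix (Fin 3) (Fin 3) K) 2 0) < 1) :
    Valued.v (((κ : GL (Fin 3) K) : Matrix (Fin 3) (Fin 3) K) 1 0) < 1 := by
  set k : Matrix (Fin 3) (Fin 3) K := ((κ : GL (Fin 3) K) : Matrix (Fin 3) (Fin 3) K) with hk
  have hint : ∀ i j, Valued.v (k i j) ≤ 1 := (mem_unitaryInt_iff.1 hκ).1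
  have hκu := (mem_unitaryGroupOfForm_antidiagonal_iff (κ : GL (Fin 3) K)).1 κ.2
  have hiso : B₀ σ 3 (k.mulVec (Pi.single 0 1)) (k.mulVec (Pi.single 0 1)) = 0 := by
    rw [hκu, B₀_single_left]; simp
  have hr0 : (0 : Fin 3).rev = 2 := rfl
  have hr1 : (1 : Fin 3).rev = 1 := rfl
  have hr2 : (2 : Fin 3).rev = 0 := rfl
  rw [Matrix.mulVec_single_one, B₀_apply, Fin.sum_univ_three, hr0, hr1, hr2] at hiso
  simp only [Matrix.col_apply] at hiso
  -- `hiso : σ(k₀₀)·k₂₀ + σ(k₁₀)·k₁₀ + σ(k₂₀)·k₀₀ = 0`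
  have e : σ (k 1 0) * k 1 0 = -(σ (k 0 0) * k 2 0 + σ (k 2 0) * k 0 0) := by linear_combination hiso
  have hsq' : Valued.v (σ (k 1 0) * k 1 0) < 1 := by
    rw [e, Valuation.map_neg]
    refine Valuation.map_add_lt _ ?_ ?_
    · rw [map_mul, hvσ]; exact (mul_le_of_le_one_left' (hint 0 0)).trans_lt h20
    · rw [map_mul, hvσ]; exact (mul_le_of_le_one_right' (hint 0 0)).trans_lt h20
  have hsq : Valued.v (k 1 0) * Valued.v (k 1 0) < 1 := by rwa [map_mul, hvσ] at hsq'
  by_contra hge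
  have h1 : Valued.v (k 1 0) = 1 := le_antisymm (hint 1 0) (not_lt.1 hge)
  rw [h1, one_mul] at hsq
  exact (lt_irrefl _) hsq

/-- **Primitive column**: for `κ ∈ K₀` with `|κ₂₀| < 1`, `|κ₀₀| = 1` (the first column of an invertible integral matrix is primitive; with §4's isotropy `|κ₁₀| < 1`).
[cite: Serre1980Trees, II.1.1] [cite: BruhatTits1972, §10] -/
theorem v_apply_zero_zero_eq_one_of_v_apply_two_zero_lt_one (hvσ : ∀ z, Valued.v (σ z) = Valued.v z)
    {κ : unitaryGroupOfForm σ ((StdForm.antidiagonal 3).over K)} (hκ : κ ∈ unitaryInt σ ((StdForm.antidiagonal 3).over K))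
    (h20 : Valued.v (((κ : GL (Fin 3) K) : Matrix (Fin 3) (Fin 3) K) 2 0) < 1) :
    Valued.v (((κ : GL (Fin 3) K) : Matrix (Fin 3) (Fin 3) K) 0 0) = 1 := by
  have hint := (mem_unitaryInt_iff.1 hκ).1
  have hinv := (mem_unitaryInt_iff.1 hκ).2
  have h10 := v_apply_one_zero_lt_one_of_v_apply_two_zero_lt_one hvσ hκ h20
  -- `Σ_j (κ⁻¹)₀ⱼ κⱼ₀ = 1`
  have hone : ((((κ : GL (Fin 3) K)⁻¹ : GL (Fin 3) K) : Matrix (Fin 3) (Fin 3) K) * ((κ : GL (Fin 3) K) : Matrix (Fin 3) (Fin 3) K)) 0 0 = 1 := by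
    rw [← Units.val_mul, inv_mul_cancel, Units.val_one, Matrix.one_apply_eq]
  rw [Matrix.mul_apply, Fin.sum_univ_three] at hone
  by_contra hne
  have h00 : Valued.v (((κ : GL (Fin 3) K) : Matrix (Fin 3) (Fin 3) K) 0 0) < 1 := lt_of_le_of_ne (hint 0 0) hne
  have hlt : Valued.v ((((κ : GL (Fin 3) K)⁻¹ : GL (Fin 3) K) : Matrix (Fin 3) (Fin 3) K) 0 0 * ((κ : GL (Fin 3) K) : Matrix (Fin 3) (Fin 3) K) 0 0 +
      (((κ : GL (Fin 3) K)⁻¹ : GL (Fin 3) K) : Matrix (Fin 3) (Fin 3) K) 0 1 * ((κ : GL (Fin 3) K) : Matrix (Fin 3) (Fin 3) K) 1 0 +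
      (((κ : GL (Fin 3) K)⁻¹ : GL (Fin 3) K) : Matrix (Fin 3) (Fin 3) K) 0 2 * ((κ : GL (Fin 3) K) : Matrix (Fin 3) (Fin 3) K) 2 0) < 1 := by
    refine Valuation.map_add_lt _ (Valuation.map_add_lt _ ?_ ?_) ?_
    · rw [map_mul]; exact (mul_le_of_le_one_left' (hinv 0 0)).trans_lt h00
    · rw [map_mul]; exact (mul_le_of_le_one_left' (hinv 0 1)).trans_lt h10
    · rw [map_mul]; exact (mul_le_of_le_one_left' (hinv 0 2)).trans_lt h20
  rw [hone, map_one] at hlt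
  exact (lt_irrefl _) hlt

/-- **`κ·N₁ = N₁ ↔ |κ₂₀| < 1`** for `κ ∈ K₀` (`σ` valuation-preserving): the modular neighbour through the line `κ̄ē₀` is the INWARD one `N₁` iff the residual point `κ̄ē₀` is `ē₀`,
iff (isotropy) `|κ₂₀| < 1` (★ `mapGL_N₁_eq_mapGL_N₁_iff`).  With §3: at a rank-one vertex of exact depth `d` the ONLY `Q_Ȳ`-null neighbour is the inward one.
[cite: BruhatTits1972, §10] [cite: Serre1980Trees, II.1.1] [cite: Tits1979, §3.5] -/
theorem mapGL_N₁_eq_iff_v_apply_two_zero_lt_one (hvσ : ∀ z, Valued.v (σ z) = Valued.v z) (hϖ : Valued.v ϖ = WithZero.exp (-1 : ℤ))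
    {κ : unitaryGroupOfForm σ ((StdForm.antidiagonal 3).over K)} (hκ : κ ∈ unitaryInt σ ((StdForm.antidiagonal 3).over K)) :
    mapGL (κ : GL (Fin 3) K) (latt (Matrix.diagonal ![(1 : K), 1, ϖ])) = latt (Matrix.diagonal ![(1 : K), 1, ϖ]) ↔
      Valued.v (((κ : GL (Fin 3) K) : Matrix (Fin 3) (Fin 3) K) 2 0) < 1 := by
  have hone : (1 : unitaryGroupOfForm σ ((StdForm.antidiagonal 3).over K)) ∈ unitaryInt σ ((StdForm.antidiagonal 3).over K) := Subgroup.one_mem _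
  have h := mapGL_N₁_eq_mapGL_N₁_iff hvσ hϖ hone hκ
  rw [Subgroup.coe_one, mapGL_one] at h
  rw [h]
  constructor
  · rintro ⟨c, hc, hall⟩
    have h2 := hall 2
    rwa [Units.val_one, Matrix.one_apply_ne (by decide : (2 : Fin 3) ≠ 0), mul_zero, sub_zero] at h2
  · intro h20
    refine ⟨((κ : GL (Fin 3) K) : Matrix (Fin 3) (Fin 3) K) 0 0, v_apply_zero_zero_eq_one_of_v_apply_two_zero_lt_one hvσ hκ h20, fun i => ?_⟩
    fin_cases i
    · simp
    · simpa [Matrix.one_apply_ne] using v_apply_one_zero_lt_one_of_v_apply_two_zero_lt_one hvσ hκ h20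
    · simpa [Matrix.one_apply_ne] using h20

end Literature.NumberTheory.Automorphic.UnitaryLatticeTree

end
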